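/-
Copyright (c) 2026 the pub-hodgecm-mathlib formalisation cell (harness21).  Prover seat hodgecm-mathlib-K2Liu-p03 (g8), Track B «K2-LIT»,
#184♮ = hLiu418 = `stmt-HodgeConjecture-24832`; socket #41, KIND 1 — (K1a-T) FILE W «∃-FREE»: the singular tail identity of ★ p863805
`K2LiuKindOneSingularTailOfRecord.htail_hsplit_of_record` RESTATED WITHOUT `∃` — index, point, exceptional set and value letter BY VALUE, head set ∕ shell set ∕
witnesses WRITTEN OUT — so that every later letter about them ((L1)∕(L4)∕(L5) counts of ★ p863488, K1a desk K2E5-p16 (g8) 01:10:41Z) is provable OUTSIDE.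
THEOREMS ONLY (no `def`, no `instance`, no notation, no named-fact hypothesis, no `sorry`).
-/
import Summits.HodgeConjecture.HodgeConjecture.Theorems.K2LiuKindOneSingularTailEuler            -- ★ p863692 FILE 1 (this seat): §1 `whittakerDelta_eq_kindWPart_mul_scalarK1_mul_prod`, §3 `kindWPart_slice_eq_sum_mul_prod`
import Summits.HodgeConjecture.HodgeConjecture.Theorems.K2LiuSiegelEisensteinKindWGlobalIntegrable -- ★ (x-c) `integrable_conj_unipDeltaChar_mul` (★ G1's `hG`)
import HarnessLib

/-!
# Crux `HLiu418`, socket #41, KIND 1 a♮ — (K1a-T) FILE W `K2LiuKindOneSingularTailOfCornerLetters`: THE TAIL IDENTITY ∃-FREE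
# `c₀ • W_{S'}(f_s)(h') = c₀ · [Σ_j (∫ conj ψ_{S'}·Finf j) · ∏_{v∈K} (∫ conj ψ_{S'}·Fv j v)] · sc¹^{K}(s) · ∏_{v ∈ Dm ∖ K} Σ_{k≤m_v}(ε_v q_v^{1−2s})^k`, `K = kindWFinset (T₀ ∪ T₁) S' h'`

Cell `hodgecm-mathlib`, crux item hLiu418 = `stmt-HodgeConjecture-24832` (helper lane `--supports … --as helper`, count-neutral), route of record `HCCMUnconditional`;
squad K2 ∕ K2Liu, road `K2_Liu`, socket #41 `sig_K2LiuSiegelEisensteinContinuation`, KIND 1, block K1-a♮.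

WHY (K1a desk K2E5-p16 (g8) 01:10:41Z ∕ this seat 01:09:48Z + 01:11:40Z).  ★ p863805 packages the K1-a♮ tail as `∃ σc gc T D Pm mτ A W, …`; the (dec) factor letters of ★ p863488
`K2LiuKindOneSingularDecayOfLetters.hdec_of_factorBounds` — the (L1) tensor count, the (L4) `(16∕3)^{#Pm S h}` count, the (L5) shell-polynomial size — are statements ABOUT those
witnesses, and nothing can be proved about an `∃`-bound witness from outside.  THIS FILE states the same identity with NOTHING hidden: for ANY index `S' ∈ M₂(L)` and ANY point
`h' ∈ H(𝔸)` (the corner index `σc(S) E₁₁` and the translate `gc S · h` of ★ `exists_cornerData_of_record` are the instance of record), an exceptional set `T₁` with the local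
VALUE LETTER off `T₁` in ★ p863366's shape (exponents `mv` supported on `Dm`), the head set IS `K := kindWFinset (T₀ ∪ T₁) S' h'` (★ (x-a) ED. 1), the shell set IS `Dm ∖ K`, the
uncontinued letters ARE the raw archimedean ∕ local twisted integrals — all written out in the conclusion.  The five sources of `K ∖ T₀` are then READ OFF ★ `kindWPlaces`'s
definition (`T₁`, `{v : h'_v ∉ K_v}`, `{v : (w_Δ)_v ∉ K_v}`, `{v : S' not integral above v}`, `{v : S'⁻¹ not integral above v}`), which is what the count letters need.
* **`htail_hsplit_of_cornerLetters`** — inputs: `χ` unitary, `f_s ∈ I_Δ(s,χ)` continuous (`hsec hcont`), Haar `νN`, `c₀ : ℝ`; the Whittaker–Euler data BY VALUE as ★ (W1)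
  (`T₀ νv hνK νinf hσ hmap hχ hfac`); the place-indexed Σ⊗ slices `Finf Fv hslice` (★ (KW-fac) (3)); per-factor integrability `hintArch hintLoc` (★ p863853 ∕ ★ (iii-fin-int));
  the index `S'`, the point `h'`, and the value letter `hval` off `T₁` with `mv Dm hm`.  OUTPUT on `{1 < re s}`: the displayed identity — ★ FILE 1 §1 at `T₀ ∪ T₁` (`hG` := ★
  (x-c)) ∘ ★ FILE 1 §3 (Fubini), `coe_kindWFinset`, `ring`.  ★ p863805 is its `choose`-packaging at `S' := σc(S) E₁₁`, `h' := gc S·h`, `T₁ := T_{★ p863366}(σc S)`,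
  `mv := ord_v τ(σc S)`, `Dm := {v : |τ|_v ≠ 1}`.
HONEST LABEL.  Count-neutral helper (a restatement for transparency; no new mathematics); it closes no socket: `HC_CM` is proved only modulo the 7 printed citations
(2 remaining named inputs: hLiu418 = `stmt-HodgeConjecture-24832`, h413 = `stmt-HodgeConjecture-24833`) until rung 0 closes.

## References
* [KudlaRallis1994] S. Kudla, S. Rallis, *A regularized Siegel–Weil formula: the first term identity*, Ann. of Math. 140 (1994): §2 (2.10)–(2.12).
* [Tan1999] V. Tan, *Poles of Siegel Eisenstein series on U(n,n)*, Canad. J. Math. 51 (1999): §3, §4 Prop. 4.8.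
* [CasselsFrohlichANT1967] Cassels–Fröhlich (eds.), *Algebraic Number Theory* (1967): Ch. XV (Tate) Thm. 3.3.1.
-/

set_option autoImplicit false
-- the mandated namespace repeats the single-problem summit's segment (`HodgeConjecture.HodgeConjecture`)
set_option linter.dupNamespace false

noncomputable section

open scoped Matrix RestrictedProduct ENNReal NNReal Topology ComplexConjugate
open NumberField IsDedekindDomain MeasureTheory Measure Filter Set

namespace Summit.HodgeConjecture.HodgeConjecture.Cruxes.HLiu418.K2LiuKindOneSingularTailOfCornerLetters

open Literature.NumberTheory.Automorphic Literature.NumberTheory.GaloisRepresentations Literature.NumberTheory.LFunctions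
open Literature.NumberTheory.GelbartRogawski1991 Literature.NumberTheory.GelbartRogawski1991.GRConstruction
open Literature.NumberTheory.GelbartRogawski1991.UnitaryDualPair
open Literature.NumberTheory.K2Lit.SiegelDoubled
open Literature.NumberTheory.K2Lit.PlaceSplitting
open Literature.MeasureTheory.RestrictedProduct
open Literature.Topology.Algebra.RestrictedProduct (inH)
open Summit.HodgeConjecture.HodgeConjecture.Cruxes.HLiu418.K2LiuSiegelUnipotentLocalDefs
open Summit.HodgeConjecture.HodgeConjecture.Cruxes.HLiu418.K2LiuSiegelUnipotentSplitDefs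
open Summit.HodgeConjecture.HodgeConjecture.Cruxes.HLiu418.K2LiuSiegelUnipotentSplitAtDefs
open Summit.HodgeConjecture.HodgeConjecture.Cruxes.HLiu418.K2LiuSiegelUnipotentFourierDefs
open Summit.HodgeConjecture.HodgeConjecture.Cruxes.HLiu418.K2LiuSiegelEisensteinKindWLetters
open Summit.HodgeConjecture.HodgeConjecture.Cruxes.HLiu418.K2LiuSiegelEisensteinKindWGlobalIntegrable (integrable_conj_unipDeltaChar_mul)
open Summit.HodgeConjecture.HodgeConjecture.Cruxes.HLiu418.K2LiuKindOneSingularTailEuler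
  (whittakerDelta_eq_kindWPart_mul_scalarK1_mul_prod kindWPart_slice_eq_sum_mul_prod)

variable (L : Type) [Field L] [NumberField L] [IsCMField L]
variable {N M : ℕ} (e : Fin N × Fin M ≃ Fin 2)
  (dV : Fin N → L) (hdV : ∀ i, IsCMField.complexConj L (dV i) = dV i)
  (dW : Fin M → L) (hdW : ∀ i, IsCMField.complexConj L (dW i) = dW i)
  [DecidableEq (HeightOneSpectrum (𝓞 (Fp L)))]
  [MeasurableSpace ↥(unipDelta L e dV hdV dW hdW)] [BorelSpace ↥(unipDelta L e dV hdV dW hdW)]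
  [MeasurableSpace ↥(unipDeltaArch L e dV hdV dW hdW)] [BorelSpace ↥(unipDeltaArch L e dV hdV dW hdW)]
  [∀ v : HeightOneSpectrum (𝓞 (Fp L)), MeasurableSpace ↥(unipDeltaLoc L e dV hdV dW hdW v)] [∀ v : HeightOneSpectrum (𝓞 (Fp L)), BorelSpace ↥(unipDeltaLoc L e dV hdV dW hdW v)]

set_option maxHeartbeats 800000 in -- MEASURED class of ★ p863805 (same statement block: the Whittaker–Euler `hmap` telescope + the two summand integrands; default 200 000 times out at `whnf` of the statement); structural `rw` + `ring`
/-- **(K1a-T) FILE W — THE TAIL IDENTITY, ∃-FREE (any index `S'`, any point `h'`).**  Inputs: `χ` unitary (`hχu`), `f_s ∈ I_Δ(s,χ)` continuous (`hsec hcont`), Haar `νN`,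
`c₀ : ℝ`; the Whittaker–Euler data BY VALUE exactly as ★ (W1) ∕ ★ p863805 (`T₀ νv hνK νinf hσ hmap hχ`, `hfac` through the own slices); the place-indexed Σ⊗ slices `Finf Fv hslice`
(★ (KW-fac) (3)); per-factor integrability `hintArch hintLoc` on `{1 < re s}`; the index `S'`, the point `h'`; an exceptional set `T₁` and the VALUE LETTER `hval` off `T₁` (★ p863366's
shape: `∫ conj ψ_{S'}(ι_v y)·Λ_{s,v}((w_Δ)_v y) dν_v = c¹_v(s)·Σ_{k≤mv v}(ε_v q_v^{1−2s})^k`) with exponents `mv` vanishing off `Dm` (`hm`).  THEN on `{1 < re s}`, with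
`K := kindWFinset (T₀ ∪ T₁) S' h'` (★ (x-a) ED. 1 — WRITTEN OUT, no `∃`):
`c₀ • W_{S'}(f_s)(h') = c₀ · [Σ_j (∫ conj ψ_{S'}(ι_∞ a)·Finf j s((w_Δ)_∞·a·h'_∞) dνinf(K)) · ∏_{v∈K} ∫ conj ψ_{S'}(ι_v y)·Fv j v s((w_Δ)_v·y·h'_v) dν_v] · [ζ^{↑K}_{L⁺}(2s) ∕ (ζ^{↑K}_{L⁺}(2s+1)·L^{↑K}(2s+2, ε_{L∕L⁺}))] · ∏_{v ∈ Dm, v ∉ K} Σ_{k≤mv v}(ε_v q_v^{1−2s})^k`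
— ★ FILE 1 §1 at `T₀ ∪ T₁` (`hG` := ★ (x-c)) ∘ ★ FILE 1 §3 ∘ `coe_kindWFinset`.  ★ p863805 `htail_hsplit_of_record` is the `choose`-packaging of this identity at the corner index of
record. [cite: KudlaRallis1994, §2 (2.10)–(2.12)] [cite: Tan1999, §3; §4 Prop. 4.8] [cite: CasselsFrohlichANT1967, Ch. XV Thm. 3.3.1] -/
theorem htail_hsplit_of_cornerLetters (hdV0 : ∀ i, dV i ≠ 0) (hdW0 : ∀ i, dW i ≠ 0)
    {χ : HeckeCharacter L} (hχu : χ.IsUnitary)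
    {f : ℂ → HA L e dV hdV dW hdW → ℂ} (hsec : ∀ s : ℂ, IsSiegelDeltaSection L e dV hdV dW hdW χ s (f s)) (hcont : ∀ s, Continuous (f s))
    (νN : Measure ↥(unipDelta L e dV hdV dW hdW)) [νN.IsHaarMeasure] (c₀ : ℝ)
    -- the Whittaker–Euler data BY VALUE (as ★ (W1)): bad set, local and archimedean carriers, the factorisation of `νN` at every `T`
    (T₀ : Finset (HeightOneSpectrum (𝓞 (Fp L))))
    (νv : ∀ v : HeightOneSpectrum (𝓞 (Fp L)), Measure ↥(unipDeltaLoc L e dV hdV dW hdW v)) [∀ v, (νv v).IsHaarMeasure] [∀ v, SigmaFinite (νv v)]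
    (hνK : ∀ v, νv v (((inH (fun v => UnitaryGroup.localInt L (IsCMField.complexConj L) (2 + 2) (hermD L e dV hdV dW hdW) v)
      (fun v => unipDeltaLoc L e dV hdV dW hdW v) v) : Subgroup ↥(unipDeltaLoc L e dV hdV dW hdW v)) : Set ↥(unipDeltaLoc L e dV hdV dW hdW v)) = 1)
    (νinf : Finset (HeightOneSpectrum (𝓞 (Fp L))) → Measure ↥(unipDeltaArch L e dV hdV dW hdW)) (hσ : ∀ T, SigmaFinite (νinf T))
    (hmap : ∀ T : Finset (HeightOneSpectrum (𝓞 (Fp L))), Measure.map (unipDeltaSplitAt L e dV hdV dW hdW T) νN =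
      (νinf T).prod ((Measure.pi fun v : T => νv v.1).prod
        (rpMeasure (fun v : {v : HeightOneSpectrum (𝓞 (Fp L)) // v ∉ T} => ((inH (fun v => UnitaryGroup.localInt L (IsCMField.complexConj L) (2 + 2) (hermD L e dV hdV dW hdW) v)
          (fun v => unipDeltaLoc L e dV hdV dW hdW v) v.1 : Subgroup ↥(unipDeltaLoc L e dV hdV dW hdW v.1)) : Set ↥(unipDeltaLoc L e dV hdV dW hdW v.1))) (fun v => νv v.1) ∅)))
    (hχ : ∀ v, v ∉ T₀ → ∀ w' : UnitaryGroup.PlacesOver L v, χ.IsUnramifiedAt w'.1)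
    (hfac : ∀ T : Finset (HeightOneSpectrum (𝓞 (Fp L))), T₀ ⊆ T →
      IsFactorizableOff L e dV hdV dW hdW T χ f (fun s x => f s (placesEmbed L (hermD L e dV hdV dW hdW) T x)))
    -- the Σ⊗ STRUCTURE of the slices, place-indexed (★ (KW-fac) `exists_kindW_factorization` (3)'s shape), ONE `m` for all `T ⊇ T₀`
    {m : ℕ} (Finf : Fin m → ℂ → UnitaryGroup.arch (Fp L) L (IsCMField.complexConj L) (2 + 2) (hermD L e dV hdV dW hdW) → ℂ)
    (Fv : Fin m → ∀ v : HeightOneSpectrum (𝓞 (Fp L)), ℂ → UnitaryGroup.localPi L (IsCMField.complexConj L) (2 + 2) (hermD L e dV hdV dW hdW) v → ℂ)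
    (hslice : ∀ T : Finset (HeightOneSpectrum (𝓞 (Fp L))), T₀ ⊆ T →
      ∀ (s : ℂ) (a : UnitaryGroup.arch (Fp L) L (IsCMField.complexConj L) (2 + 2) (hermD L e dV hdV dW hdW))
        (y : Π v : ↥T, UnitaryGroup.localPi L (IsCMField.complexConj L) (2 + 2) (hermD L e dV hdV dW hdW) v.1),
        f s (placesEmbed L (hermD L e dV hdV dW hdW) T (a, y)) = ∑ j, Finf j s a * ∏ v : ↥T, Fv j v.1 s (y v))
    -- per-FACTOR integrability on `{1 < re s}` at every index and every point (★ p863853 `hintArch_of_isArchSiegelSection` ∕ ★ (iii-fin-int))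
    (hintArch : ∀ (S' : Matrix (Fin 2) (Fin 2) L) (h' : HA L e dV hdV dW hdW) (T : Finset (HeightOneSpectrum (𝓞 (Fp L)))) (s : ℂ) (j : Fin m), 1 < s.re →
      Integrable (fun a : ↥(unipDeltaArch L e dV hdV dW hdW) =>
        conj (unipDeltaChar L e dV hdV dW hdW S'
            (UnitaryGroup.archToAdelic (Fp L) L (IsCMField.complexConj L) (2 + 2) (hermD L e dV hdV dW hdW)
              (a : UnitaryGroup.arch (Fp L) L (IsCMField.complexConj L) (2 + 2) (hermD L e dV hdV dW hdW))) : ℂ) *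
          Finf j s (UnitaryGroup.archPart (Fp L) L (IsCMField.complexConj L) (2 + 2) (hermD L e dV hdV dW hdW) (weylDelta L e dV hdV dW hdW) *
              (a : UnitaryGroup.arch (Fp L) L (IsCMField.complexConj L) (2 + 2) (hermD L e dV hdV dW hdW)) *
              UnitaryGroup.archPart (Fp L) L (IsCMField.complexConj L) (2 + 2) (hermD L e dV hdV dW hdW) h')) (νinf T))
    (hintLoc : ∀ (S' : Matrix (Fin 2) (Fin 2) L) (h' : HA L e dV hdV dW hdW) (v : HeightOneSpectrum (𝓞 (Fp L))) (s : ℂ) (j : Fin m), 1 < s.re →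
      Integrable (fun y : ↥(unipDeltaLoc L e dV hdV dW hdW v) =>
        conj (unipDeltaChar L e dV hdV dW hdW S'
            (locToAdelic L e dV hdV dW hdW v (y : UnitaryGroup.localPi L (IsCMField.complexConj L) (2 + 2) (hermD L e dV hdV dW hdW) v)) : ℂ) *
          Fv j v s (UnitaryGroup.evalPlace (Fp L) L (IsCMField.complexConj L) (2 + 2) (hermD L e dV hdV dW hdW) v
                (UnitaryGroup.finPart (Fp L) L (IsCMField.complexConj L) (2 + 2) (hermD L e dV hdV dW hdW) (weylDelta L e dV hdV dW hdW)) *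
              (y : UnitaryGroup.localPi L (IsCMField.complexConj L) (2 + 2) (hermD L e dV hdV dW hdW) v) *
              UnitaryGroup.evalPlace (Fp L) L (IsCMField.complexConj L) (2 + 2) (hermD L e dV hdV dW hdW) v
                (UnitaryGroup.finPart (Fp L) L (IsCMField.complexConj L) (2 + 2) (hermD L e dV hdV dW hdW) h'))) (νv v))
    -- THE INDEX, THE POINT, THE EXCEPTIONAL SET AND THE VALUE LETTER (★ p863366's shape, exponents `mv` supported on `Dm`) — ALL BY VALUE
    (S' : Matrix (Fin 2) (Fin 2) L) (h' : HA L e dV hdV dW hdW)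
    (T₁ : Finset (HeightOneSpectrum (𝓞 (Fp L)))) (mv : HeightOneSpectrum (𝓞 (Fp L)) → ℕ) (Dm : Finset (HeightOneSpectrum (𝓞 (Fp L)))) (hm : ∀ v, v ∉ Dm → mv v = 0)
    (hval : ∀ v, v ∉ T₁ → ∀ s : ℂ, 1 < s.re →
      ∫ y, conj (unipDeltaChar L e dV hdV dW hdW S'
            (locToAdelic L e dV hdV dW hdW v (y : UnitaryGroup.localPi L (IsCMField.complexConj L) (2 + 2) (hermD L e dV hdV dW hdW) v)) : ℂ) *
          LambdaLoc L e dV hdV dW hdW v χ s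
            (UnitaryGroup.evalPlace (Fp L) L (IsCMField.complexConj L) (2 + 2) (hermD L e dV hdV dW hdW) v
                (UnitaryGroup.finPart (Fp L) L (IsCMField.complexConj L) (2 + 2) (hermD L e dV hdV dW hdW) (weylDelta L e dV hdV dW hdW)) *
              (y : UnitaryGroup.localPi L (IsCMField.complexConj L) (2 + 2) (hermD L e dV hdV dW hdW) v)) ∂(νv v) =
        (1 - (v.residueCard : ℂ) ^ (-(2 * s + 1))) * (1 - (quadraticHeckeCharCM L).valueAtUniformizer v * (v.residueCard : ℂ) ^ (-(2 * s + 2))) /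
          (1 - (v.residueCard : ℂ) ^ (-(2 * s))) *
          ∑ k ∈ Finset.range (mv v + 1), ((quadraticHeckeCharCM L).valueAtUniformizer v * (v.residueCard : ℂ) ^ (1 - 2 * s)) ^ k)
    {s : ℂ} (hs : 1 < s.re) :
    (c₀ : ℝ) • whittakerDelta L e dV hdV dW hdW νN S' (f s) h' =
      (c₀ : ℂ) *
          (∑ j, (∫ a, conj (unipDeltaChar L e dV hdV dW hdW S'
              (UnitaryGroup.archToAdelic (Fp L) L (IsCMField.complexConj L) (2 + 2) (hermD L e dV hdV dW hdW)
                (a : UnitaryGroup.arch (Fp L) L (IsCMField.complexConj L) (2 + 2) (hermD L e dV hdV dW hdW))) : ℂ) *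
            Finf j s (UnitaryGroup.archPart (Fp L) L (IsCMField.complexConj L) (2 + 2) (hermD L e dV hdV dW hdW) (weylDelta L e dV hdV dW hdW) *
                (a : UnitaryGroup.arch (Fp L) L (IsCMField.complexConj L) (2 + 2) (hermD L e dV hdV dW hdW)) *
                UnitaryGroup.archPart (Fp L) L (IsCMField.complexConj L) (2 + 2) (hermD L e dV hdV dW hdW) h')
            ∂(νinf (kindWFinset L e dV hdV dW hdW (T₀ ∪ T₁) S' h'))) *
            ∏ v ∈ kindWFinset L e dV hdV dW hdW (T₀ ∪ T₁) S' h',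
              ∫ y, conj (unipDeltaChar L e dV hdV dW hdW S'
                (locToAdelic L e dV hdV dW hdW v (y : UnitaryGroup.localPi L (IsCMField.complexConj L) (2 + 2) (hermD L e dV hdV dW hdW) v)) : ℂ) *
              Fv j v s (UnitaryGroup.evalPlace (Fp L) L (IsCMField.complexConj L) (2 + 2) (hermD L e dV hdV dW hdW) v
                    (UnitaryGroup.finPart (Fp L) L (IsCMField.complexConj L) (2 + 2) (hermD L e dV hdV dW hdW) (weylDelta L e dV hdV dW hdW)) *
                  (y : UnitaryGroup.localPi L (IsCMField.complexConj L) (2 + 2) (hermD L e dV hdV dW hdW) v) *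
                  UnitaryGroup.evalPlace (Fp L) L (IsCMField.complexConj L) (2 + 2) (hermD L e dV hdV dW hdW) v
                    (UnitaryGroup.finPart (Fp L) L (IsCMField.complexConj L) (2 + 2) (hermD L e dV hdV dW hdW) h')) ∂(νv v)) *
        (partialStandardL ((kindWFinset L e dV hdV dW hdW (T₀ ∪ T₁) S' h' : Finset (HeightOneSpectrum (𝓞 (Fp L)))) : Set (HeightOneSpectrum (𝓞 (Fp L)))) (fun _ => {1}) (2 * s) /
          (partialStandardL ((kindWFinset L e dV hdV dW hdW (T₀ ∪ T₁) S' h' : Finset (HeightOneSpectrum (𝓞 (Fp L)))) : Set (HeightOneSpectrum (𝓞 (Fp L)))) (fun _ => {1}) (2 * s + 1) *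
            partialStandardL ((kindWFinset L e dV hdV dW hdW (T₀ ∪ T₁) S' h' : Finset (HeightOneSpectrum (𝓞 (Fp L)))) : Set (HeightOneSpectrum (𝓞 (Fp L))))
              (fun v => {(quadraticHeckeCharCM L).valueAtUniformizer v}) (2 * s + 2))) *
        ∏ v ∈ Dm.filter (fun v => v ∉ kindWFinset L e dV hdV dW hdW (T₀ ∪ T₁) S' h'),
          ∑ k ∈ Finset.range (mv v + 1), ((quadraticHeckeCharCM L).valueAtUniformizer v * (v.residueCard : ℂ) ^ (1 - 2 * s)) ^ k := by
  have hs' : 1 / 2 < s.re := by linarith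
  have hs2 : ((2 : ℕ) : ℝ) / 2 < s.re := by norm_num; exact hs
  have hsub : T₀ ⊆ kindWFinset L e dV hdV dW hdW (T₀ ∪ T₁) S' h' := Finset.subset_union_left.trans (subset_kindWFinset L e dV hdV dW hdW _ _ _)
  -- ★ FILE 1 §1 at `T₀ ∪ T₁`, `hG` := ★ (x-c), `hI` := the value letter off `T₁ ⊆ T₀ ∪ T₁ ⊆ K`
  have h1 := whittakerDelta_eq_kindWPart_mul_scalarK1_mul_prod L e dV hdV dW hdW (T₀ ∪ T₁) νN νv hνK νinf hσ hmap (χ := χ)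
    (fun v hv w' => hχ v (fun h0 => hv (Finset.mem_union_left _ h0)) w')
    (fT := fun T s x => f s (placesEmbed L (hermD L e dV hdV dW hdW) T x)) (fun T hT => hfac T (Finset.subset_union_left.trans hT))
    S' hs' h' (integrable_conj_unipDeltaChar_mul L e dV hdV dW hdW hdV0 hdW0 hχu hs2 (hsec s) (hcont s) νN S' h') mv Dm hm
    (fun v hv => hval v (fun hvT => hv (subset_kindWPlaces L e dV hdV dW hdW (Finset.mem_coe.2 (Finset.mem_union_right _ hvT)))) s hs)
  -- ★ FILE 1 §3 (Fubini) with the joint `hint` from the two factor letters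
  haveI := hσ (kindWFinset L e dV hdV dW hdW (T₀ ∪ T₁) S' h')
  have h3 := kindWPart_slice_eq_sum_mul_prod L e dV hdV dW hdW (kindWFinset L e dV hdV dW hdW (T₀ ∪ T₁) S' h')
    (νinf (kindWFinset L e dV hdV dW hdW (T₀ ∪ T₁) S' h')) νv Finf Fv (hslice _ hsub) S' s h'
    (fun j => hintArch _ _ _ s j hs) (fun j v => hintLoc _ _ v.1 s j hs)
  rw [Complex.real_smul, h1, ← coe_kindWFinset L e dV hdV dW hdW (T₀ ∪ T₁) S' h', h3]
  ring

end Summit.HodgeConjecture.HodgeConjecture.Cruxes.HLiu418.K2LiuKindOneSingularTailOfCornerLetters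

end
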